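import Summits.ResolutionOfSingularities.ResolutionOfSingularities.Theorems.HilbertSamuelEliminationSigmaMaxModificationsCorridor3WLadderMovingBeta
import Literature.AlgebraicGeometry.Resolution.PointBlowupHsFunMono
import Mathlib.FieldTheory.Perfect
import HarnessLib

/-!
# [OURS · L1 W4.2] Row β of `stub_Wlow3M_two` is CHAIN-STABLE: perfect residue fields propagate along canonical near chains

Stub worker res-L1-w42-stub-3 (gen 3), crux chain w42, line `w_ladder` v5 (skeleton sha16 `e55bf4f23146f08b` on
stmt-ResolutionOfSingularities-19249), registered stub `WLadder.stub_Wlow3M_two`, helper row β `Moving.Wlow3TwoPerfectM`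
(origin predicate «`¬ QCharRegime p` ∧ `QPerfectResidueField`» = perfect residue field AT THE ORIGIN only).

The β regime is read on the ORIGIN, but every use of it (the perfect-residue-field form of CJS Thm. 3.14, memo
`HOME/L/res-L1-w42-stub-3/BETA-UNITS-SCOPE.md` rows [A]) happens at LATER marked points `x_n ∈ X_n` of the chain. This file proves
that nothing is lost: along `Reaches R N ν (MarkedStage.init X x) s`

* the stage maps to the origin's scheme by a composite of blow-downs `φ : s.W ⟶ X`, which is PROPER (tree
  `IsBlowup.isProper`), with `φ.base s.pt = x` (`Reaches.exists_hom`);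
* the marked point stays CLOSED (`Reaches.isClosed_pt`; one step: tree `CanonicalNearStep.isClosed_pt`);
* hence the residue-field extension `κ(x) → κ(x_n)` is FINITE (tree `finite_residueFieldMap_of_isClosed`, Stacks 01TB) —
  `Reaches.exists_hom_finite_residueFieldMap`;
* hence `κ(x_n)` is PERFECT when `κ(x)` is (Mathlib `Algebra.IsAlgebraic.perfectField`): `perfectField_of_ringHom_finite`,
  `Reaches.perfectField_residueField`, and along an infinite chain `chain_perfectField_residueField`;
* packaged for the row: from a β-origin every marked stage of every chain is again a «perfect closed point»
  (`qPerfectResidueField_of_reaches`, `qPerfectResidueField_chain`).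

(γ — imperfect residue field at the origin — also propagates along finite extensions, since a field with a perfect finite
extension is itself perfect; that direction is needed by no row and is not proved here.)

OURS (cell res-hironaka, slot W4.2); NOT statements of the manuscript [Hironaka2017] nor of [CossartJannsenSaito2020];
AI-drafted, weaker than expert review. References: CJS LNM 2270 Thm. 3.14 and p. 52 (the group scheme `B_{P,x'}`), p. 107
[CossartJannsenSaito2020]; Stacks 01TB [StacksProject]; tree `…Corridor3WLadderMovingDefs` (plan-1 helpers v3.6).
-/

noncomputable section

-- plan-1/idea-2 module setting kept verbatim (namespace `…Corridor3.Moving` re-enters `…Corridor3`)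
set_option linter.dupNamespace false

open CategoryTheory AlgebraicGeometry TopologicalSpace
open Summit.ResolutionOfSingularities.ResolutionOfSingularities.Theorems.CampaignW42
open Literature.AlgebraicGeometry.Resolution Literature.RingTheory.HilbertSamuel
open Literature.AlgebraicGeometry.CossartJannsenSaito2020
open Summit.ResolutionOfSingularities.ResolutionOfSingularities.Theses.HilbertSamuelElimination
open Summit.ResolutionOfSingularities.ResolutionOfSingularities.Theorems.SigmaMaxModificationsCorridor3

namespace Summit.ResolutionOfSingularities.ResolutionOfSingularities.Theorems.SigmaMaxModificationsCorridor3.Moving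

universe u

section BetaStable

open Summit.ResolutionOfSingularities.ResolutionOfSingularities.Theorems.SigmaMaxModificationsCorridor3.Helpers
  (QPerfectResidueField QCharRegime)

variable {R : ∀ S : Scheme.{u}, CentreSeq S → Prop} {N : ℕ} {ν : ℕ → ℕ}

/-! ## §1. The composite blow-down along `Reaches` -/

/-- One canonical near step: the new stage is the chosen blow-up, its structure map to the old stage is PROPER and sends the
marked point to the marked point. [folklore] -/
theorem CanonicalNearStep.exists_hom {s s' : MarkedStage.{u}} (h : CanonicalNearStep R N ν s s') :
    ∃ φ : s'.W ⟶ s.W, IsProper φ ∧ φ.base s'.pt = s.pt := by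
  obtain ⟨C, P', hln, x', -, hx', -, -, rfl⟩ := h
  haveI := s.ln
  exact ⟨blowup.π C, (blowup.isBlowup C).isProper, hx'⟩

/-- Along `Reaches`: a PROPER composite of blow-downs `φ : s'.W ⟶ s.W` with `φ(x') = x`. [folklore] -/
theorem Reaches.exists_hom {s s' : MarkedStage.{u}} (h : Reaches R N ν s s') :
    ∃ φ : s'.W ⟶ s.W, IsProper φ ∧ φ.base s'.pt = s.pt := by
  induction h with
  | refl => exact ⟨𝟙 _, inferInstance, rfl⟩
  | tail _ hstep ih =>
    obtain ⟨φ, hφ, hpt⟩ := ih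
    obtain ⟨ψ, hψ, hpt'⟩ := CanonicalNearStep.exists_hom hstep
    refine ⟨ψ ≫ φ, inferInstance, ?_⟩
    rw [← hpt, ← hpt']
    rfl

/-- Along `Reaches` from a stage with CLOSED marked point, the marked point stays closed. [folklore] -/
theorem Reaches.isClosed_pt {s s' : MarkedStage.{u}} (h : Reaches R N ν s s') (hs : IsClosed ({s.pt} : Set s.W)) :
    IsClosed ({s'.pt} : Set s'.W) := by
  induction h with
  | refl => exact hs
  | tail _ hstep _ => exact hstep.isClosed_pt

/-- **Finite residue extension along `Reaches`**: from a stage with closed marked point, `κ(x) → κ(x')` along the composite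
blow-down is a FINITE ring map (closed point + locally of finite type, Stacks 01TB). [cite: StacksProject, Tag 01TB] -/
theorem Reaches.exists_hom_finite_residueFieldMap {s s' : MarkedStage.{u}} (h : Reaches R N ν s s')
    (hs : IsClosed ({s.pt} : Set s.W)) :
    ∃ φ : s'.W ⟶ s.W, IsProper φ ∧ φ.base s'.pt = s.pt ∧
      (IsLocalRing.ResidueField.map (φ.stalkMap s'.pt).hom).Finite := by
  obtain ⟨φ, hφ, hpt⟩ := Reaches.exists_hom h
  exact ⟨φ, hφ, hpt, finite_residueFieldMap_of_isClosed φ (Reaches.isClosed_pt h hs)⟩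

/-! ## §2. Perfectness passes along finite ring maps of fields -/

/-- A field receiving a FINITE ring map from a perfect field is perfect (an algebraic extension of a perfect field is perfect).
[folklore] -/
theorem perfectField_of_ringHom_finite {K L : Type*} [Field K] [Field L] [PerfectField K] (f : K →+* L)
    (hf : f.Finite) : PerfectField L := by
  letI : Algebra K L := f.toAlgebra
  haveI : Module.Finite K L := hf
  exact Algebra.IsAlgebraic.perfectField K

/-! ## §3. β is chain-stable -/

/-- **Perfect residue fields propagate along `Reaches`**: if the marked point of `s` is closed with perfect residue field, so
is the marked point of every stage reached from `s`. [folklore] -/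
theorem Reaches.perfectField_residueField {s s' : MarkedStage.{u}} (h : Reaches R N ν s s')
    (hs : IsClosed ({s.pt} : Set s.W)) (hperf : PerfectField (IsLocalRing.ResidueField (s.W.presheaf.stalk s.pt))) :
    PerfectField (IsLocalRing.ResidueField (s'.W.presheaf.stalk s'.pt)) := by
  obtain ⟨φ, -, hpt, hfin⟩ := Reaches.exists_hom_finite_residueFieldMap h hs
  have hperf' : PerfectField (IsLocalRing.ResidueField (s.W.presheaf.stalk (φ.base s'.pt))) := by
    rw [hpt]
    exact hperf
  exact perfectField_of_ringHom_finite _ hfin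

/-- Chain form: along an infinite chain of canonical near steps whose start is reached from a stage with closed, perfect
marked point, EVERY marked point is closed with perfect residue field. [folklore] -/
theorem chain_perfectField_residueField {s₀ : MarkedStage.{u}} {c : ℕ → MarkedStage.{u}}
    (h0 : Reaches R N ν s₀ (c 0)) (hstep : ∀ n, CanonicalNearStep R N ν (c n) (c (n + 1)))
    (hs : IsClosed ({s₀.pt} : Set s₀.W)) (hperf : PerfectField (IsLocalRing.ResidueField (s₀.W.presheaf.stalk s₀.pt)))
    (n : ℕ) :
    IsClosed ({(c n).pt} : Set (c n).W) ∧ PerfectField (IsLocalRing.ResidueField ((c n).W.presheaf.stalk (c n).pt)) :=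
  ⟨Reaches.isClosed_pt (reaches_chain h0 hstep n) hs,
    Reaches.perfectField_residueField (reaches_chain h0 hstep n) hs hperf⟩

/-- **β AT THE ORIGIN ⇒ β AT EVERY STAGE** (origin-predicate form): from a maximal origin with perfect residue field, every
marked stage reached along `S(X, ν)` has a closed marked point satisfying `QPerfectResidueField`. [folklore] -/
theorem qPerfectResidueField_of_reaches {p : ℕ} {X : Scheme.{u}} [IsLocallyNoetherian X] {x : X}
    (hx : IsMaximalOrigin p N ν X x) (hperf : QPerfectResidueField N ν X x) {s : MarkedStage.{u}}
    (hs : Reaches R N ν (MarkedStage.init X x) s) :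
    IsClosed ({s.pt} : Set s.W) ∧ QPerfectResidueField N ν s.W s.pt :=
  ⟨Reaches.isClosed_pt hs hx.isClosed, Reaches.perfectField_residueField hs hx.isClosed hperf⟩

/-- Chain form of the previous statement (the shape in which the β rows quantify). [folklore] -/
theorem qPerfectResidueField_chain {p : ℕ} {X : Scheme.{u}} [IsLocallyNoetherian X] {x : X}
    (hx : IsMaximalOrigin p N ν X x) (hperf : QPerfectResidueField N ν X x) {c : ℕ → MarkedStage.{u}}
    (h0 : Reaches R N ν (MarkedStage.init X x) (c 0)) (hstep : ∀ n, CanonicalNearStep R N ν (c n) (c (n + 1))) (n : ℕ) :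
    IsClosed ({(c n).pt} : Set (c n).W) ∧ QPerfectResidueField N ν (c n).W (c n).pt :=
  qPerfectResidueField_of_reaches hx hperf (reaches_chain h0 hstep n)

/-- The composite blow-down from a marked stage reached from a maximal origin down to `X` is proper, hits the origin, and has
finite residue extension `κ(x) → κ(x_n)` — the form consumed by unit/bridge constructions (localisation at `x`). [folklore] -/
theorem exists_hom_of_reaches_init {p : ℕ} {X : Scheme.{u}} [IsLocallyNoetherian X] {x : X}
    (hx : IsMaximalOrigin p N ν X x) {s : MarkedStage.{u}} (hs : Reaches R N ν (MarkedStage.init X x) s) :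
    ∃ φ : s.W ⟶ X, IsProper φ ∧ φ.base s.pt = x ∧ (IsLocalRing.ResidueField.map (φ.stalkMap s.pt).hom).Finite :=
  Reaches.exists_hom_finite_residueFieldMap hs hx.isClosed

end BetaStable

end Summit.ResolutionOfSingularities.ResolutionOfSingularities.Theorems.SigmaMaxModificationsCorridor3.Moving

end
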